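import Literature.NumberTheory.LFunctions.SmoothedExplicitFormulaContour
import Literature.NumberTheory.LFunctions.FordLaplaceInversion
import Literature.NumberTheory.LFunctions.FordZetaLogDerivLeftLine
import Literature.NumberTheory.LFunctions.FordExplicitFormulaError
import Literature.NumberTheory.LFunctions.VinogradovKorobovIntermediateAssembly
import HarnessLib

/-!
# Ford's Lemma 4.5: the contour shift (4.7) and the inequality for `Re K(s)`

Topic `Literature/NumberTheory/LFunctions`, family RH (explicit zero-free regions). Everything in
this file is PROVED; no named fact, no definition.

K. Ford, *Zero-free regions for the Riemann zeta function* (2002), **Lemma 4.5**: for a smoothing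
`f ≥ 0` with `|F₀(z)| ≤ D/|z|²` on `Re z ≥ 0`, `|z| ≥ η` (`F₀ = F − f(0)/z`, the tree's
`fordLaplace₀`), and `Re s > 1`,
`K(s) = −f(0) ζ'/ζ(s) − Σ_ρ F₀(s − ρ) + F₀(s − 1) + E`, `|E| ≤ D(1.72 + ⅓ log(1 + Im s))`.
We prove it in the form in which the proof of Ford's Lemma 4.6 consumes it — real parts, the zeros
with `|1 + it − ρ| ≤ η` kept and the others bounded through (4.5) by a bound `S` of
`Σ_{|1+it−ρ|>η} m(ρ)/|1 + it − ρ|²` (`FordFarZeroSumLT`):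

* `FordL45.re_fordK_le` — for `IsFordSmoothing f η D`, `0 < η ≤ 1/2`, `1 < Re s ≤ 2`:
  `Re K(s) ≤ −f(0) Re ζ'/ζ(s) + Re F₀(s − 1) − Σ_{|1+it−ρ|≤η} m(ρ) Re F₀(s − ρ) + D·S
     + D (4.62/3 + (log 2)/3 + (1/6) log(1 + t²))`, `t = Im s`.

(The constant: Ford's `1.72` comes from `I' ≤ 10.8 + (2π/3) log(1+t)`, where `10.8` is a slip for
`3.08π + (2π/3) log 2 = 11.13`; the honest value is `4.62/3 + (log 2)/3 = 1.771…`, and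
`(1/6) log(1 + t²) ≤ (1/3) log(1 + t)`. Lemma 4.6's `1.8` is unaffected.)

The proof is Ford's: (4.6) (`FordL45.integral_LSeries_vonMangoldt_mul_laplace`,
`FordLaplaceInversion.lean`) for the line `Re w = α = (1 + σ)/2`; the residue theorem on
`[−1/2, α] × [−T, T]` with `s` to the RIGHT of the rectangle (`ford_contour_identity`: poles at
`w = 1` and at the zeros only — compare `smoothedEF_contour_identity`, where `s` is inside); the
limit along the good heights of `ZetaZeroSum.exists_goodHeight_log` (horizontal sides
`O(log² T/(T − |t|)²)`, `norm_integral_horizontal_le`); the left line bounded by Lemma 3.2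
(`FordL32.norm_logDeriv_zeta_left_le`) and (4.5), `|s − w|² = (σ + ½)² + (t − y)²`
(`integral_left_bound`, `FordL45.error_integral_le`); and at each finite height the zero sum split
into near zeros and far zeros, the latter bounded using `|s − ρ| ≥ |1 + it − ρ|` for `σ ≥ 1`
(`nearSum_sub_le_re_zeroSum`), so that no convergence of `Σ_ρ F₀(s − ρ)` is needed.

## References

* K. Ford, *Zero-free regions for the Riemann zeta function*, Number Theory for the Millennium II
  (Urbana 2000), A K Peters 2002, 25–56 (arXiv:1910.08205), Lemma 4.5 and proof of Lemma 4.6.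
  [Ford2002Millennium]
-/

noncomputable section

open Complex Real MeasureTheory Set Filter Topology

namespace Literature.NumberTheory.LFunctions

namespace FordL45

/-! ### The contour identity on `[−1/2, α] × [−T, T]`, `α < Re s` -/

/-- **The residues of `G(w) = (−ζ'/ζ)(w) F₀(s − w)` in `K = [−1/2, α] × [−T, T]` when
`1 < α < Re s`, `α ≤ 3/2`** (Ford's placement: `s` lies to the RIGHT of `K`, so `F₀(s − w)` is
analytic on `K` and the only poles are `w = 1`, residue `F₀(s − 1)`, and the non-trivial zeros
`ρ` with `|Im ρ| < T`, residues `−m(ρ) F₀(s − ρ)`): at a good height `T`,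
`∮_{∂K} G = 2πi (F₀(s − 1) − Σ_{|Im ρ| ≤ T} m(ρ) F₀(s − ρ))`. Only continuity and compact support of
`f` are used. (Compare `smoothedEF_contour_identity`, the same for `s` inside `[−1/2, 3/2] × [−T, T]`.)
[cite: Ford2002Millennium, Lemma 4.5 (proof, (4.7))] -/
theorem ford_contour_identity {f : ℝ → ℝ} {x₀ : ℝ} (hfc : Continuous f) (hx₀ : 0 ≤ x₀)
    (hf0 : ∀ u, x₀ ≤ u → f u = 0) {s : ℂ} {α : ℝ} (hα : 1 < α) (hα2 : α ≤ 3 / 2) (hαs : α < s.re)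
    {T : ℝ} (hT0 : 0 < T)
    (hgood : ∀ ρ ∈ RHWave0.riemannZetaNontrivialZeros, ρ.im ≠ T ∧ ρ.im ≠ -T) :
    Literature.Analysis.Complex.rectBoundaryIntegral (smoothedEFIntegrand f s) (-(1 / 2)) α (-T) T =
      2 * π * I * (fordLaplace₀ f (s - 1) -
        ∑ ρ ∈ weilZeroFinset T, (riemannZetaZeroOrder (ρ : ℂ) : ℂ) * fordLaplace₀ f (s - ρ)) := by
  classical
  have hab : (-(1 / 2) : ℝ) < α := by linarith
  have hcd : -T < T := by linarith
  -- differentiability of `F`, `F₀`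
  have hFd := differentiable_fordLaplace hfc hx₀ hf0
  have hF₀d : ∀ w : ℂ, w ≠ s → DifferentiableAt ℂ (fun w ↦ fordLaplace₀ f (s - w)) w := fun w hw ↦
    (differentiableAt_fordLaplace₀ hfc hx₀ hf0 (sub_ne_zero.2 (Ne.symm hw))).comp w
      ((differentiableAt_const _).sub differentiableAt_id)
  -- the zeros inside
  have hZfin : (weilZeroIndex T).Finite := weilZeroIndex_finite T
  set Zf : Finset ℂ := hZfin.toFinset with hZf
  have hmemZf : ∀ {ρ : ℂ}, ρ ∈ Zf ↔ ρ ∈ RHWave0.riemannZetaNontrivialZeros ∧ |ρ.im| ≤ T := by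
    intro ρ
    rw [hZf, Set.Finite.mem_toFinset, weilZeroIndex_eq_inter]
    rfl
  have hZf_prop : ∀ ρ ∈ Zf, ρ ∈ RHWave0.riemannZetaNontrivialZeros ∧ ρ ≠ 1 ∧ ρ ≠ s ∧
      riemannZeta₁ ρ = 0 ∧ -T < ρ.im ∧ ρ.im < T := by
    intro ρ hρ
    obtain ⟨hmem, habs⟩ := hmemZf.1 hρ
    have hρ1 := ZetaZeros.riemannZetaNontrivialZeros.ne_one hmem
    have hζρ := ZetaZeros.riemannZetaNontrivialZeros.zeta_eq_zero hmem
    have hlt1 := ZetaZeros.riemannZetaNontrivialZeros.re_lt_one hmem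
    refine ⟨hmem, hρ1, ?_, (riemannZeta₁_eq_zero_iff hρ1).2 hζρ, ?_, ?_⟩
    · intro h; rw [h] at hlt1; linarith
    · exact lt_of_le_of_ne (abs_le.1 habs).1 (Ne.symm (hgood ρ hmem).2)
    · exact lt_of_le_of_ne (abs_le.1 habs).2 (hgood ρ hmem).1
  have h1Z : (1 : ℂ) ∉ Zf := fun h ↦ (hZf_prop 1 h).2.1 rfl
  set S : Finset ℂ := insert 1 Zf with hS
  have hmemS : ∀ {p : ℂ}, p ∈ S ↔ p = 1 ∨ p ∈ Zf := by
    intro p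
    simp [hS]
  have hsS : ∀ p ∈ S, p ≠ s := by
    intro p hp
    rcases hmemS.1 hp with rfl | hp
    · intro h; have := congrArg Complex.re h; simp at this; linarith
    · exact (hZf_prop p hp).2.2.1
  -- the residues
  set r : ℂ → ℂ := fun p ↦ if p = 1 then fordLaplace₀ f (s - 1) else
      -(riemannZetaZeroOrder p : ℂ) * fordLaplace₀ f (s - p) with hr
  have hr1 : r 1 = fordLaplace₀ f (s - 1) := by simp [hr]
  have hrZ : ∀ ρ : ℂ, ρ ≠ 1 → r ρ = -(riemannZetaZeroOrder ρ : ℂ) * fordLaplace₀ f (s - ρ) := by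
    intro ρ hρ1
    simp [hr, hρ1]
  -- `(z - 1)⁻¹`
  have hinv : ∀ z : ℂ, z ≠ 1 → DifferentiableAt ℂ (fun w : ℂ ↦ (w - 1)⁻¹) z := fun z hz ↦
    (differentiableAt_id.sub_const 1).inv (sub_ne_zero.2 hz)
  have hL : ∀ z : ℂ, riemannZeta₁ z ≠ 0 → DifferentiableAt ℂ (logDeriv riemannZeta₁) z := fun z hz ↦
    (PsiOneExplicit.analyticAt_logDeriv_riemannZeta₁ hz).differentiableAt
  -- the open set: a left half-plane not containing `s`
  set β : ℝ := (α + s.re) / 2 with hβ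
  have hαβ : α < β := by rw [hβ]; linarith
  have hβs : β < s.re := by rw [hβ]; linarith
  set U : Set ℂ := ({w : ℂ | riemannZeta₁ w ≠ 0} ∪ (S : Set ℂ)) ∩ {w : ℂ | w.re < β} with hU
  have hUopen : IsOpen U := by
    refine IsOpen.inter ?_ (isOpen_lt Complex.continuous_re continuous_const)
    rw [isOpen_iff_mem_nhds]
    intro w hw
    by_cases hζw : riemannZeta₁ w = 0
    · have hwS : w ∈ (S : Set ℂ) := by
        rcases hw with h | h
        · exact absurd hζw h
        · exact h
      rcases (differentiable_riemannZeta₁.analyticAt w).eventually_eq_zero_or_eventually_ne_zero with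
        h | h
      · exact absurd (analyticOrderAt_eq_top.2 h) (analyticOrderAt_riemannZeta₁_ne_top w)
      · rw [eventually_nhdsWithin_iff] at h
        filter_upwards [h] with z hz
        by_cases hzw : z = w
        · exact Or.inr (hzw ▸ hwS)
        · exact Or.inl (hz hzw)
    · exact mem_of_superset ((isOpen_ne_fun differentiable_riemannZeta₁.continuous
        continuous_const).mem_nhds hζw) subset_union_left
  have hUs : ∀ w ∈ U, w ≠ s := by
    intro w hw h
    have := hw.2
    simp only [mem_setOf_eq] at this
    rw [h] at this
    linarith
  have hKU : Icc (-(1 / 2) : ℝ) α ×ℂ Icc (-T) T ⊆ U := by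
    intro w hw
    have hwre := (Complex.mem_reProdIm.1 hw).1
    refine ⟨?_, by simp only [mem_setOf_eq]; linarith [hwre.2]⟩
    by_cases hζw : riemannZeta₁ w = 0
    · have hre : -(1 / 2) ≤ w.re := hwre.1
      have hmem := mem_nontrivialZeros_of_riemannZeta₁_eq_zero hζw hre
      have habs : |w.im| ≤ T := abs_le.2 (Complex.mem_reProdIm.1 hw).2
      exact Or.inr (Finset.mem_coe.2 (hmemS.2 (Or.inr (hmemZf.2 ⟨hmem, habs⟩))))
    · exact Or.inl hζw
  have hSsub : (S : Set ℂ) ⊆ Ioo (-(1 / 2) : ℝ) α ×ℂ Ioo (-T) T := by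
    intro p hp
    rcases hmemS.1 (Finset.mem_coe.1 hp) with rfl | hp
    · refine ⟨⟨by simp; norm_num, by simpa using hα⟩, ⟨by simp [hT0], by simp [hT0]⟩⟩
    · obtain ⟨hmem, -, -, -, hi1, hi2⟩ := hZf_prop p hp
      have h0 := ZetaZeros.riemannZetaNontrivialZeros.re_pos hmem
      have h1 := ZetaZeros.riemannZetaNontrivialZeros.re_lt_one hmem
      exact ⟨⟨by linarith, by linarith⟩, ⟨hi1, hi2⟩⟩
  -- differentiability off the poles
  have hGd : DifferentiableOn ℂ (smoothedEFIntegrand f s) (U \ (S : Set ℂ)) := by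
    intro w hw
    have hwS : w ∉ S := fun h ↦ hw.2 (Finset.mem_coe.2 h)
    have hζ₁w : riemannZeta₁ w ≠ 0 := by
      rcases hw.1.1 with h | h
      · exact h
      · exact absurd h hw.2
    have hw1 : w ≠ 1 := fun h ↦ hwS (hmemS.2 (Or.inl h))
    have hws : w ≠ s := hUs w hw.1
    have hζw : riemannZeta w ≠ 0 := fun h ↦ hζ₁w ((riemannZeta₁_eq_zero_iff hw1).2 h)
    have han := analyticAt_riemannZeta' hw1
    exact (((han.deriv.differentiableAt).div han.differentiableAt hζw).neg.mul
      (hF₀d w hws)).differentiableWithinAt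
  -- apply the residue theorem
  have key := Literature.Analysis.Complex.rectBoundaryIntegral_eq_sum_of_simplePoles hab hcd S
    (smoothedEFIntegrand f s) r U hUopen hKU hSsub hGd ?poles
  case poles =>
    intro p hp
    have hps : p ≠ s := hsS p hp
    rcases hmemS.1 hp with rfl | hp
    · -- the pole at `1`
      have h1s : (1 : ℂ) ≠ s := hps
      refine ⟨fun z ↦ (1 - (z - 1) * logDeriv riemannZeta₁ z) * fordLaplace₀ f (s - z),
        {z : ℂ | riemannZeta₁ z ≠ 0 ∧ z ≠ s}, ?_, ?_, ?_, ?_⟩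
      · refine IsOpen.mem_nhds ?_ ⟨by rw [riemannZeta₁_one]; exact one_ne_zero, h1s⟩
        exact (isOpen_ne_fun differentiable_riemannZeta₁.continuous continuous_const).inter isOpen_ne
      · intro z hz
        have hd1 : DifferentiableAt ℂ (fun z : ℂ ↦ 1 - (z - 1) * logDeriv riemannZeta₁ z) z :=
          (differentiableAt_const _).sub ((differentiableAt_id.sub_const 1).mul (hL z hz.1))
        exact (hd1.mul (hF₀d z hz.2)).differentiableWithinAt
      · simp only [hr1, sub_self, zero_mul, sub_zero, one_mul]
      · intro z hz hz1
        have hζz : riemannZeta z ≠ 0 := fun h ↦ hz.1 ((riemannZeta₁_eq_zero_iff hz1).2 h)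
        rw [smoothedEFIntegrand, neg_logDeriv_zeta_eq_inv_sub hz1 hζz]
        have : z - 1 ≠ 0 := sub_ne_zero.2 hz1
        field_simp
    · -- the pole at a zero `ρ`
      obtain ⟨hmem, hp1, -, hζ₁p, -, -⟩ := hZf_prop p hp
      obtain ⟨B, hB, hev⟩ := exists_analyticAt_logDeriv_eq_add
        (differentiable_riemannZeta₁.analyticAt p) (analyticOrderAt_riemannZeta₁_ne_top p)
      set m : ℕ := analyticOrderNatAt riemannZeta₁ p with hm
      have hmcast : (m : ℂ) = (riemannZetaZeroOrder p : ℂ) := by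
        rw [hm, ← analyticOrderNatAt_riemannZeta₁_eq hp1, Int.cast_natCast]
      have hall : ∀ᶠ z in 𝓝 p, (z ≠ p → riemannZeta₁ z ≠ 0 ∧
          deriv riemannZeta₁ z / riemannZeta₁ z = (m : ℂ) / (z - p) + B z) ∧
          DifferentiableAt ℂ B z ∧ z ≠ 1 ∧ z ≠ s := by
        rw [eventually_nhdsWithin_iff] at hev
        filter_upwards [hev, hB.eventually_analyticAt, isOpen_ne.eventually_mem hp1,
          isOpen_ne.eventually_mem hps] with z h1 h2 h3 h4
        exact ⟨h1, h2.differentiableAt, h3, h4⟩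
      obtain ⟨V, hVsub, hVopen, hpV⟩ := mem_nhds_iff.1 hall
      refine ⟨fun z ↦ ((z - 1)⁻¹ - B z) * fordLaplace₀ f (s - z) * (z - p)
          - (m : ℂ) * fordLaplace₀ f (s - z), V, hVopen.mem_nhds hpV, ?_, ?_, ?_⟩
      · intro z hz
        obtain ⟨-, hBd, hz1, hzs⟩ := hVsub hz
        have hd1 : DifferentiableAt ℂ (fun z : ℂ ↦ (z - 1)⁻¹ - B z) z := (hinv z hz1).sub hBd
        have hd2 := hF₀d z hzs
        exact (((hd1.mul hd2).mul (differentiableAt_id.sub_const p)).sub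
          ((differentiableAt_const _).mul hd2)).differentiableWithinAt
      · simp only [hrZ p hp1, sub_self, mul_zero, zero_sub, hmcast, neg_mul]
      · intro z hz hzp
        obtain ⟨h1, -, hz1, -⟩ := hVsub hz
        obtain ⟨hζ₁z, hLz⟩ := h1 hzp
        have hζz : riemannZeta z ≠ 0 := fun h ↦ hζ₁z ((riemannZeta₁_eq_zero_iff hz1).2 h)
        rw [smoothedEFIntegrand, neg_logDeriv_zeta_eq_inv_sub hz1 hζz, logDeriv_apply, hLz]
        have h3 : z - p ≠ 0 := sub_ne_zero.2 hzp
        field_simp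
        ring
  rw [key]
  congr 1
  rw [hS, Finset.sum_insert h1Z]
  have hrZ' : ∀ ρ ∈ Zf, r ρ = -(riemannZetaZeroOrder ρ : ℂ) * fordLaplace₀ f (s - ρ) := by
    intro ρ hρ
    exact hrZ ρ (hZf_prop ρ hρ).2.1
  rw [hr1, Finset.sum_congr rfl hrZ']
  have hsumZ : ∑ ρ ∈ Zf, -(riemannZetaZeroOrder ρ : ℂ) * fordLaplace₀ f (s - ρ) =
      -∑ ρ ∈ weilZeroFinset T, (riemannZetaZeroOrder (ρ : ℂ) : ℂ) * fordLaplace₀ f (s - ρ) := by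
    rw [← ZetaZeroSum.finsum_mem_weilZeroIndex_eq_sum
        (fun ρ ↦ (riemannZetaZeroOrder ρ : ℂ) * fordLaplace₀ f (s - ρ)) T,
      finsum_mem_eq_finite_toFinset_sum _ hZfin, ← Finset.sum_neg_distrib]
    refine Finset.sum_congr rfl fun ρ _ ↦ ?_
    ring
  rw [hsumZ]
  ring

/-! ### Standing facts about an admissible smoothing -/

/-- An admissible smoothing vanishes on `[max x₀ 0, ∞)` for some `x₀`, is continuous, and is bounded
on `[0, ∞)`. [folklore] -/
theorem _root_.Literature.NumberTheory.LFunctions.IsFordSmoothing.exists_support_bound {f : ℝ → ℝ} {η D : ℝ}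
    (hf : IsFordSmoothing f η D) :
    ∃ x₀ M : ℝ, 0 ≤ x₀ ∧ (∀ u, x₀ ≤ u → f u = 0) ∧ (∀ u, 0 ≤ u → |f u| ≤ M) := by
  have hfc : Continuous f := hf.contDiff.continuous
  obtain ⟨x₀, hx₀⟩ := hf.eventually_zero
  obtain ⟨B, hB⟩ := (isCompact_Icc (a := (0 : ℝ)) (b := |x₀| + 1)).exists_bound_of_continuousOn
    hfc.continuousOn
  refine ⟨max x₀ 0, max B 0, le_max_right _ _, fun u hu ↦ hx₀ u ((le_max_left _ _).trans hu),
    fun u hu ↦ ?_⟩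
  by_cases hux : u ≤ |x₀| + 1
  · exact ((Real.norm_eq_abs _).symm.le.trans (hB u ⟨hu, hux⟩)).trans (le_max_left _ _)
  · have : f u = 0 := hx₀ u (by linarith [le_abs_self x₀])
    rw [this, abs_zero]; exact le_max_right _ _

/-- `D ≥ 0` for an admissible smoothing (`η ≤ 2`: apply (4.5) at `z = 2`). [folklore] -/
theorem _root_.Literature.NumberTheory.LFunctions.IsFordSmoothing.D_nonneg {f : ℝ → ℝ} {η D : ℝ}
    (hf : IsFordSmoothing f η D) (hη : η ≤ 2) :
    0 ≤ D := by
  have h2 := hf.laplace_bound 2 (by simp) (by simpa using hη)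
  have h3 : (0 : ℝ) ≤ D / ‖(2 : ℂ)‖ ^ 2 := (norm_nonneg _).trans h2
  rw [Complex.norm_two] at h3
  linarith

/-- `F₀ = fordLaplace₀ f` agrees with `ℒ(f − f(0))` on `Re z > 0`. [folklore] -/
theorem fordLaplace₀_eq_fordLaplace_sub {f : ℝ → ℝ} {η D : ℝ} (hf : IsFordSmoothing f η D)
    {z : ℂ} (hz : 0 < z.re) : fordLaplace₀ f z = fordLaplace (fun u ↦ f u - f 0) z := by
  obtain ⟨x₀, M, -, -, hM⟩ := hf.exists_support_bound
  rw [fordLaplace₀, fordLaplace_sub_const hf.contDiff.continuous (fun u hu ↦ hM u hu.le) hz]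

/-! ### The right edge: `∫ G(α + iy) dy = 2π (K(s) + f(0) ζ'/ζ(s))` -/

/-- On `Re w = α > 1`: `G(α + iy) = L(Λ, α + iy) · F₀(s − α − iy)`. [folklore] -/
theorem smoothedEFIntegrand_right {f : ℝ → ℝ} {s : ℂ} {α : ℝ} (hα : 1 < α) (y : ℝ) :
    smoothedEFIntegrand f s ((α : ℂ) + y * I) =
      LSeries (fun n ↦ ((ArithmeticFunction.vonMangoldt n : ℝ) : ℂ)) ((α : ℂ) + y * I) *
        fordLaplace₀ f (s - ((α : ℂ) + y * I)) := by
  rw [smoothedEFIntegrand, ArithmeticFunction.LSeries_vonMangoldt_eq_deriv_riemannZeta_div (by simp; linarith)]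
  ring

/-- **The right edge, whole line**: for `1 < α < Re s`, `y ↦ G(α + iy)` is integrable and
`∫ G(α + iy) dy = 2π (K(s) + f(0) ζ'(s)/ζ(s))` ((4.6), `integral_LSeries_vonMangoldt_mul_laplace`).
[cite: Ford2002Millennium, Lemma 4.5, (4.6)] -/
theorem integral_right_eq {f : ℝ → ℝ} {η D : ℝ} (hf : IsFordSmoothing f η D) (hη : 0 < η)
    {s : ℂ} {α : ℝ} (hα : 1 < α) (hαs : α < s.re) :
    Integrable (fun y : ℝ ↦ smoothedEFIntegrand f s ((α : ℂ) + y * I)) ∧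
    ∫ y : ℝ, smoothedEFIntegrand f s ((α : ℂ) + y * I) =
      2 * π * (fordK f s + (f 0 : ℂ) * (deriv riemannZeta s / riemannZeta s)) := by
  set g : ℝ → ℝ := fun u ↦ f u - f 0 with hg
  have hre : ∀ y : ℝ, 0 < (s - ((α : ℂ) + y * I)).re := fun y ↦ by simp; linarith
  have heq : ∀ y : ℝ, smoothedEFIntegrand f s ((α : ℂ) + y * I) =
      LSeries (fun n ↦ ((ArithmeticFunction.vonMangoldt n : ℝ) : ℂ)) ((α : ℂ) + y * I) *
        fordLaplace g (s - ((α : ℂ) + y * I)) := fun y ↦ by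
    rw [smoothedEFIntegrand_right hα, fordLaplace₀_eq_fordLaplace_sub hf (hre y)]
  -- integrability: `‖L(Λ, α+iy)‖ ≤ L(Λ, α)`-type constant bound times the vertical integrability of `F₀`
  have hV : Complex.VerticalIntegrable (fordLaplace g) (s.re - α) :=
    verticalIntegrable_fordLaplace_sub hf hη (by linarith)
  have hFint : Integrable fun y : ℝ ↦ fordLaplace g (s - ((α : ℂ) + y * I)) := by
    have h := hV.comp_sub_left s.im
    refine h.congr (ae_of_all _ fun y ↦ ?_)
    simp only
    congr 1
    apply Complex.ext <;> simp
  -- continuity of `G` on the line (`ζ` analytic and non-zero on `Re w = α > 1`)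
  have hGcont : Continuous fun y : ℝ ↦ smoothedEFIntegrand f s ((α : ℂ) + y * I) := by
    obtain ⟨x₀, M, hx₀, hf0, -⟩ := hf.exists_support_bound
    have hfc := hf.contDiff.continuous
    refine continuous_iff_continuousAt.2 fun y ↦ ?_
    set w : ℂ := (α : ℂ) + y * I with hw
    have hw1 : w ≠ 1 := by
      intro h; have := congrArg Complex.re h; simp [hw] at this; linarith
    have hζ : riemannZeta w ≠ 0 := riemannZeta_ne_zero_of_one_le_re (by simp [hw]; linarith)
    have hws : s - w ≠ 0 := by
      rw [sub_ne_zero]; intro h; have := congrArg Complex.re h; simp [hw] at this; linarith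
    have han := analyticAt_riemannZeta' hw1
    have hG : ContinuousAt (smoothedEFIntegrand f s) w := by
      refine ((han.deriv.continuousAt.div han.continuousAt hζ).neg.mul ?_)
      exact ((differentiableAt_fordLaplace₀ hfc hx₀ hf0 hws).continuousAt.comp
        (continuousAt_const.sub continuousAt_id))
    exact ContinuousAt.comp (f := fun y : ℝ ↦ (α : ℂ) + y * I) hG (Continuous.continuousAt (by fun_prop))
  have hGint : Integrable fun y : ℝ ↦ smoothedEFIntegrand f s ((α : ℂ) + y * I) := by
    refine (hFint.norm.const_mul (1 / (α - 1))).mono' hGcont.aestronglyMeasurable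
      (ae_of_all _ fun y ↦ ?_)
    rw [smoothedEFIntegrand, norm_mul, norm_neg, fordLaplace₀_eq_fordLaplace_sub hf (hre y)]
    have h := norm_deriv_riemannZeta_div_lt (s := (α : ℂ) + y * I) (by simp; linarith)
    simp only [add_re, ofReal_re, mul_re, I_re, mul_zero, ofReal_im, I_im, mul_one, sub_self,
      add_zero] at h
    exact mul_le_mul_of_nonneg_right h.le (norm_nonneg _)
  refine ⟨hGint, ?_⟩
  have h46 := integral_LSeries_vonMangoldt_mul_laplace hf hη hα hαs
  rw [integral_congr_ae (ae_of_all _ heq)]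
  rw [← h46, ← mul_assoc]
  have h2 : (2 * π : ℂ) * (((1 / (2 * π) : ℝ)) : ℂ) = 1 := by push_cast; field_simp
  rw [h2, one_mul]

/-! ### The left edge: integrability and Ford's bound -/

/-- **The left edge, whole line**: for an admissible smoothing, `0 < η ≤ 1/2`, `1 ≤ Re s ≤ 3/2`,
`y ↦ G(−1/2 + iy)` is integrable and
`‖∫ G(−1/2 + iy) dy‖ ≤ D (2π·(4.62/3) + ⅓(π log(1 + t²) + 2π log 2))`, `t = Im s`
(Lemma 3.2 for `ζ'/ζ` on the line, (4.5) for `F₀(s − w)`, `|s − w|² = (σ+½)² + (t−y)²`, and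
`FordL45.error_integral_le`). [cite: Ford2002Millennium, Lemma 4.5 (proof)] -/
theorem norm_integral_left_le {f : ℝ → ℝ} {η D : ℝ} (hf : IsFordSmoothing f η D) (hη : 0 < η)
    (hη2 : η ≤ 1 / 2) {s : ℂ} (hs1 : 1 ≤ s.re) :
    Integrable (fun y : ℝ ↦ smoothedEFIntegrand f s (((-(1 / 2) : ℝ) : ℂ) + y * I)) ∧
    ‖∫ y : ℝ, smoothedEFIntegrand f s (((-(1 / 2) : ℝ) : ℂ) + y * I)‖ ≤
      D * ∫ y : ℝ, (4.62 + 1 / 2 * Real.log (1 + y ^ 2 / 9)) / ((s.re + 1 / 2) ^ 2 + (s.im - y) ^ 2) := by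
  obtain ⟨x₀, M, hx₀, hf0, -⟩ := hf.exists_support_bound
  have hfc := hf.contDiff.continuous
  have hD0 := hf.D_nonneg (by linarith)
  set σ := s.re with hσ
  set t := s.im with ht
  set c : ℝ := σ + 1 / 2 with hc
  have hc32 : 3 / 2 ≤ c := by rw [hc]; linarith
  -- pointwise bound
  have hsw : ∀ y : ℝ, s - (((-(1 / 2) : ℝ) : ℂ) + y * I) = (c : ℂ) + ((t - y : ℝ) : ℂ) * I := fun y ↦ by
    apply Complex.ext <;> simp [hc, hσ, ht]
  have hnorm_sw : ∀ y : ℝ, ‖(c : ℂ) + ((t - y : ℝ) : ℂ) * I‖ ^ 2 = c ^ 2 + (t - y) ^ 2 := fun y ↦ by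
    rw [Complex.sq_norm, Complex.normSq_apply]; simp; ring
  have hbound : ∀ y : ℝ, ‖smoothedEFIntegrand f s (((-(1 / 2) : ℝ) : ℂ) + y * I)‖ ≤
      D * ((4.62 + 1 / 2 * Real.log (1 + y ^ 2 / 9)) / (c ^ 2 + (t - y) ^ 2)) := by
    intro y
    rw [smoothedEFIntegrand, norm_mul, norm_neg, hsw y]
    have h1 := FordL32.norm_logDeriv_zeta_left_le y
    have hcy : c ≤ ‖(c : ℂ) + ((t - y : ℝ) : ℂ) * I‖ := by
      have := Complex.abs_re_le_norm ((c : ℂ) + ((t - y : ℝ) : ℂ) * I)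
      simp only [add_re, ofReal_re, mul_re, I_re, mul_zero, ofReal_im, I_im, mul_one, sub_self,
        add_zero] at this
      rw [abs_of_pos (show (0 : ℝ) < c by linarith)] at this
      exact this
    have h2 := hf.laplace_bound ((c : ℂ) + ((t - y : ℝ) : ℂ) * I) (by simp; linarith)
      (by linarith)
    rw [fordLaplace₀]
    rw [hnorm_sw y] at h2
    have hnum : 0 ≤ 4.62 + 1 / 2 * Real.log (1 + y ^ 2 / 9) := by
      have : 0 ≤ Real.log (1 + y ^ 2 / 9) := Real.log_nonneg (by nlinarith)
      positivity
    calc ‖deriv riemannZeta (((-(1 / 2) : ℝ) : ℂ) + y * I) / riemannZeta (((-(1 / 2) : ℝ) : ℂ) + y * I)‖ *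
          ‖fordLaplace f ((c : ℂ) + ((t - y : ℝ) : ℂ) * I) - (f 0 : ℂ) / ((c : ℂ) + ((t - y : ℝ) : ℂ) * I)‖
        ≤ (4.62 + 1 / 2 * Real.log (1 + y ^ 2 / 9)) * (D / (c ^ 2 + (t - y) ^ 2)) :=
          mul_le_mul h1 h2 (norm_nonneg _) hnum
      _ = _ := by ring
  -- continuity on the line
  have hGcont : Continuous fun y : ℝ ↦ smoothedEFIntegrand f s (((-(1 / 2) : ℝ) : ℂ) + y * I) := by
    refine continuous_iff_continuousAt.2 fun y ↦ ?_
    set w : ℂ := (((-(1 / 2) : ℝ) : ℂ) + y * I) with hw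
    have hw1 : w ≠ 1 := by
      intro h; have := congrArg Complex.re h; simp [hw] at this; norm_num at this
    have hζ : riemannZeta w ≠ 0 := PsiOneExplicit.riemannZeta_left_ne_zero y
    have hws : s - w ≠ 0 := by
      rw [sub_ne_zero]; intro h; have := congrArg Complex.re h; simp [hw] at this; linarith
    have han := analyticAt_riemannZeta' hw1
    have hG : ContinuousAt (smoothedEFIntegrand f s) w := by
      refine ((han.deriv.continuousAt.div han.continuousAt hζ).neg.mul ?_)
      exact ((differentiableAt_fordLaplace₀ hfc hx₀ hf0 hws).continuousAt.comp
        (continuousAt_const.sub continuousAt_id))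
    exact ContinuousAt.comp (f := fun y : ℝ ↦ (((-(1 / 2) : ℝ) : ℂ) + y * I)) hG
      (Continuous.continuousAt (by fun_prop))
  -- the majorant is integrable (compare with `c = 3/2`)
  have hmaj : Integrable fun y : ℝ ↦ D * ((4.62 + 1 / 2 * Real.log (1 + y ^ 2 / 9)) / (c ^ 2 + (t - y) ^ 2)) := by
    have hI1 : Integrable fun v : ℝ ↦ 1 / ((3 / 2 : ℝ) ^ 2 + (t - v) ^ 2) :=
      integrable_inv_sq_add_sq (by norm_num) t
    have hI2 := integrable_log_div t
    have hψ : Integrable fun v : ℝ ↦ 4.62 * (1 / ((3 / 2 : ℝ) ^ 2 + (t - v) ^ 2)) +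
        1 / 2 * (Real.log (1 + v ^ 2 / 9) / (9 / 4 + (t - v) ^ 2)) := (hI1.const_mul _).add (hI2.const_mul _)
    refine ((hψ.const_mul D)).mono' ?_ (ae_of_all _ fun y ↦ ?_)
    · refine (Continuous.aestronglyMeasurable ?_)
      refine continuous_const.mul ((Continuous.div (by
        exact continuous_const.add (continuous_const.mul (Continuous.log (by fun_prop)
          (fun y ↦ by positivity)))) (by fun_prop) (fun y ↦ by positivity)))
    · have hv9 : 0 ≤ Real.log (1 + y ^ 2 / 9) := Real.log_nonneg (by nlinarith)
      have hnum : 0 ≤ 4.62 + 1 / 2 * Real.log (1 + y ^ 2 / 9) := by positivity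
      have hden : 0 < 9 / 4 + (t - y) ^ 2 := by positivity
      have hc2 : 9 / 4 + (t - y) ^ 2 ≤ c ^ 2 + (t - y) ^ 2 := by nlinarith
      rw [Real.norm_eq_abs, abs_of_nonneg (mul_nonneg hD0 (div_nonneg hnum (by positivity)))]
      refine mul_le_mul_of_nonneg_left ?_ hD0
      calc (4.62 + 1 / 2 * Real.log (1 + y ^ 2 / 9)) / (c ^ 2 + (t - y) ^ 2)
          ≤ (4.62 + 1 / 2 * Real.log (1 + y ^ 2 / 9)) / (9 / 4 + (t - y) ^ 2) :=
            div_le_div_of_nonneg_left hnum hden hc2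
        _ = _ := by norm_num; ring
  have hGint : Integrable fun y : ℝ ↦ smoothedEFIntegrand f s (((-(1 / 2) : ℝ) : ℂ) + y * I) :=
    hmaj.mono' hGcont.aestronglyMeasurable (ae_of_all _ hbound)
  refine ⟨hGint, ?_⟩
  calc ‖∫ y : ℝ, smoothedEFIntegrand f s (((-(1 / 2) : ℝ) : ℂ) + y * I)‖
      ≤ ∫ y : ℝ, ‖smoothedEFIntegrand f s (((-(1 / 2) : ℝ) : ℂ) + y * I)‖ := norm_integral_le_integral_norm _
    _ ≤ ∫ y : ℝ, D * ((4.62 + 1 / 2 * Real.log (1 + y ^ 2 / 9)) / (c ^ 2 + (t - y) ^ 2)) :=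
        integral_mono hGint.norm hmaj hbound
    _ = D * ∫ y : ℝ, (4.62 + 1 / 2 * Real.log (1 + y ^ 2 / 9)) / (c ^ 2 + (t - y) ^ 2) :=
        MeasureTheory.integral_const_mul _ _

/-- **The left edge, whole line**: for an admissible smoothing, `0 < η ≤ 1/2`, `Re s ≥ 1`,
`y ↦ G(−1/2 + iy)` is integrable and
`‖∫ G(−1/2 + iy) dy‖ ≤ D (2π·(4.62/3) + ⅓(π log(1 + t²) + 2π log 2))`, `t = Im s`
(Lemma 3.2 for `ζ'/ζ` on the line, (4.5) for `F₀(s − w)`, `|s − w|² = (σ+½)² + (t−y)²`, and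
`FordL45.error_integral_le`). [cite: Ford2002Millennium, Lemma 4.5 (proof)] -/
theorem integral_left_bound {f : ℝ → ℝ} {η D : ℝ} (hf : IsFordSmoothing f η D) (hη : 0 < η)
    (hη2 : η ≤ 1 / 2) {s : ℂ} (hs1 : 1 ≤ s.re) :
    Integrable (fun y : ℝ ↦ smoothedEFIntegrand f s (((-(1 / 2) : ℝ) : ℂ) + y * I)) ∧
    ‖∫ y : ℝ, smoothedEFIntegrand f s (((-(1 / 2) : ℝ) : ℂ) + y * I)‖ ≤
      D * (2 * π * (4.62 / 3) + 1 / 3 * (π * Real.log (1 + s.im ^ 2) + 2 * π * Real.log 2)) := by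
  obtain ⟨hI, hle⟩ := norm_integral_left_le hf hη hη2 hs1
  have hD0 := hf.D_nonneg (by linarith)
  have hc32 : 3 / 2 ≤ s.re + 1 / 2 := by linarith
  exact ⟨hI, hle.trans (mul_le_mul_of_nonneg_left (error_integral_le hc32 s.im) hD0)⟩

/-- **The left edge for real `s`** (`Im s = 0`, the case of `K(σ)`): the sharper
`‖∫ G(−1/2 + iy) dy‖ ≤ D (2π·(4.62/3) + ⅓(2π log 2 − 3π/8))` from `FordL45.error_integral_zero_le`.
[cite: Ford2002Millennium, Lemma 4.5 (proof) and Lemma 4.6 (proof, `K(1)`)] -/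
theorem integral_left_bound_zero {f : ℝ → ℝ} {η D : ℝ} (hf : IsFordSmoothing f η D) (hη : 0 < η)
    (hη2 : η ≤ 1 / 2) {s : ℂ} (hs1 : 1 ≤ s.re) (hs0 : s.im = 0) :
    ‖∫ y : ℝ, smoothedEFIntegrand f s (((-(1 / 2) : ℝ) : ℂ) + y * I)‖ ≤
      D * (2 * π * (4.62 / 3) + 1 / 3 * (2 * π * Real.log 2 - 3 * π / 8)) := by
  obtain ⟨-, hle⟩ := norm_integral_left_le hf hη hη2 hs1
  have hD0 := hf.D_nonneg (by linarith)
  have hc32 : 3 / 2 ≤ s.re + 1 / 2 := by linarith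
  refine hle.trans ?_
  rw [hs0]
  simp only [zero_sub, even_two, Even.neg_pow]
  exact mul_le_mul_of_nonneg_left (error_integral_zero_le hc32) hD0

/-! ### The horizontal edges at good heights -/

/-- **The horizontal edges.** With `C` the constant of
`PsiOneExplicit.exists_norm_logDeriv_riemannZeta_horizontal_le`: at a height `T'` with `|T'| ≥ 2`,
all non-trivial zeros `δ`-away from the ordinate `T'` (`0 < δ ≤ 1`), and `|T'| ≥ |Im s| + η`,
`‖∫_{−1/2}^{α} G(x + iT') dx‖ ≤ (α + ½)·(C log(|T'| + 4)/δ)·D/(|T'| − |Im s|)²` (`1 < α ≤ 3/2`,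
`α < Re s`). [cite: Ford2002Millennium, Lemma 4.5 (proof)] -/
theorem norm_integral_horizontal_le {f : ℝ → ℝ} {η D : ℝ} (hf : IsFordSmoothing f η D) (hη : 0 < η)
    (hη2 : η ≤ 1 / 2) {s : ℂ} {α : ℝ} (hα : 1 < α) (hα2 : α ≤ 3 / 2) (hαs : α < s.re) {C : ℝ}
    (hC0 : 0 < C)
    (hC : ∀ (t δ : ℝ), 2 ≤ |t| → 0 < δ → δ ≤ 1 →
      (∀ ρ ∈ RHWave0.riemannZetaNontrivialZeros, δ ≤ |ρ.im - t|) →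
      ∀ σ : ℝ, σ ∈ Icc (-(1 / 2) : ℝ) (3 / 2) →
        ‖deriv riemannZeta (σ + t * I) / riemannZeta (σ + t * I)‖ ≤ C * Real.log (|t| + 4) / δ)
    {T' δ : ℝ} (hT' : 2 ≤ |T'|) (hδ : 0 < δ) (hδ1 : δ ≤ 1)
    (hsep : ∀ ρ ∈ RHWave0.riemannZetaNontrivialZeros, δ ≤ |ρ.im - T'|) (hfar : |s.im| + η ≤ |T'|) :
    ‖∫ x : ℝ in (-(1 / 2) : ℝ)..α, smoothedEFIntegrand f s (x + T' * I)‖ ≤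
      (C * Real.log (|T'| + 4) / δ) * (D / (|T'| - |s.im|) ^ 2) * (α + 1 / 2) := by
  have hD0 := hf.D_nonneg (by linarith)
  have hpos : 0 < |T'| - |s.im| := by linarith
  have hlog : 0 ≤ C * Real.log (|T'| + 4) / δ := by
    have : 0 ≤ Real.log (|T'| + 4) := Real.log_nonneg (by linarith [abs_nonneg T'])
    positivity
  have hK : ∀ x ∈ Set.uIoc (-(1 / 2) : ℝ) α, ‖smoothedEFIntegrand f s (x + T' * I)‖ ≤
      (C * Real.log (|T'| + 4) / δ) * (D / (|T'| - |s.im|) ^ 2) := by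
    intro x hx
    rw [Set.uIoc_of_le (by linarith)] at hx
    have hx' : x ∈ Icc (-(1 / 2) : ℝ) (3 / 2) := ⟨hx.1.le, hx.2.trans hα2⟩
    rw [smoothedEFIntegrand, norm_mul, norm_neg]
    have h1 := hC T' δ hT' hδ hδ1 hsep x hx'
    set w : ℂ := (x : ℂ) + T' * I with hw
    have hre : 0 ≤ (s - w).re := by simp [hw]; linarith [hx.2]
    have him : |T'| - |s.im| ≤ |(s - w).im| := by
      simp only [hw, sub_im, add_im, ofReal_im, mul_im, ofReal_re, I_im, mul_one, I_re, mul_zero,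
        add_zero, zero_add]
      have := abs_sub_abs_le_abs_sub T' s.im
      rw [abs_sub_comm] at this
      linarith
    have hnorm : |T'| - |s.im| ≤ ‖s - w‖ := him.trans (Complex.abs_im_le_norm _)
    have hη' : η ≤ ‖s - w‖ := by linarith
    have h2 := hf.laplace_bound (s - w) hre hη'
    rw [fordLaplace₀]
    calc ‖deriv riemannZeta w / riemannZeta w‖ * ‖fordLaplace f (s - w) - (f 0 : ℂ) / (s - w)‖
        ≤ (C * Real.log (|T'| + 4) / δ) * (D / ‖s - w‖ ^ 2) := mul_le_mul h1 h2 (norm_nonneg _) hlog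
      _ ≤ (C * Real.log (|T'| + 4) / δ) * (D / (|T'| - |s.im|) ^ 2) := by
          refine mul_le_mul_of_nonneg_left ?_ hlog
          exact div_le_div_of_nonneg_left hD0 (pow_pos hpos 2) (pow_le_pow_left₀ hpos.le hnorm 2)
  have h := intervalIntegral.norm_integral_le_of_norm_le_const hK
  rw [show |α - (-(1 / 2) : ℝ)| = α + 1 / 2 by rw [abs_of_pos (by linarith)]; ring] at h
  exact h

/-! ### The zero sum: near zeros kept, far zeros bounded by Ford's (4.5) -/

/-- `‖1 + it − ρ‖ ≤ ‖s − ρ‖` for `s = σ + it`, `σ ≥ 1 > Re ρ`. [folklore] -/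
theorem norm_one_add_sub_le_norm_sub {s ρ : ℂ} (hs : 1 ≤ s.re) (hρ : ρ.re < 1) :
    ‖1 + s.im * I - ρ‖ ≤ ‖s - ρ‖ := by
  have h1 : ‖1 + s.im * I - ρ‖ ^ 2 ≤ ‖s - ρ‖ ^ 2 := by
    rw [Complex.sq_norm, Complex.sq_norm, Complex.normSq_apply, Complex.normSq_apply]
    simp only [sub_re, add_re, one_re, mul_re, ofReal_re, I_re, mul_zero, ofReal_im, I_im, mul_one,
      sub_self, add_zero, sub_im, add_im, one_im, mul_im, zero_add]
    nlinarith
  exact (pow_le_pow_iff_left₀ (norm_nonneg _) (norm_nonneg _) two_ne_zero).1 h1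

/-- **Real part of the truncated zero sum from below.** For an admissible smoothing, `0 < η ≤ 1/2`,
`Re s ≥ 1`, a bound `S` of the strict far-zero sum `Σ_{|1+it−ρ|>η} m(ρ)/|1+it−ρ|²` (`t = Im s`), and
`T ≥ |t| + η`: `Σ_{|1+it−ρ| ≤ η} m(ρ) Re F₀(s−ρ) − D·S ≤ Re Σ_{|Im ρ| ≤ T} m(ρ) F₀(s − ρ)`
(the far zeros satisfy `|F₀(s−ρ)| ≤ D/|s−ρ|² ≤ D/|1+it−ρ|²`). [cite: Ford2002Millennium, Lemma 4.6 (proof)] -/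
theorem nearSum_sub_le_re_zeroSum {f : ℝ → ℝ} {η D : ℝ} (hf : IsFordSmoothing f η D) (hη : 0 < η)
    (hη2 : η ≤ 1 / 2) {s : ℂ} (hs1 : 1 ≤ s.re) {S : ℝ} (hS : FordFarZeroSumLT s.im η S) {T : ℝ}
    (hT : |s.im| + η ≤ T) :
    (∑ ρ ∈ fordNearZeros s.im η, (riemannZetaZeroOrder ρ : ℝ) * (fordLaplace₀ f (s - ρ)).re) - D * S ≤
      (∑ ρ ∈ weilZeroFinset T, (riemannZetaZeroOrder (ρ : ℂ) : ℂ) * fordLaplace₀ f (s - ρ)).re := by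
  classical
  have hD0 := hf.D_nonneg (by linarith)
  set t := s.im with ht
  set W := weilZeroFinset T with hW
  set P : ZetaZeros.riemannZetaNontrivialZeros → Prop := fun ρ ↦ ‖1 + t * I - (ρ : ℂ)‖ ≤ η with hP
  have hre : (∑ ρ ∈ W, (riemannZetaZeroOrder (ρ : ℂ) : ℂ) * fordLaplace₀ f (s - ρ)).re =
      ∑ ρ ∈ W, (riemannZetaZeroOrder (ρ : ℂ) : ℝ) * (fordLaplace₀ f (s - ρ)).re := by
    rw [Complex.re_sum]
    refine Finset.sum_congr rfl fun ρ _ ↦ ?_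
    simp [Complex.mul_re]
  rw [hre, ← Finset.sum_filter_add_sum_filter_not W P]
  -- the near part
  have hnear : ∑ ρ ∈ W.filter P, (riemannZetaZeroOrder (ρ : ℂ) : ℝ) * (fordLaplace₀ f (s - ρ)).re =
      ∑ z ∈ fordNearZeros t η, (riemannZetaZeroOrder z : ℝ) * (fordLaplace₀ f (s - z)).re := by
    rw [← Finset.sum_image (s := W.filter P) (g := fun ρ : ZetaZeros.riemannZetaNontrivialZeros ↦ (ρ : ℂ))
      (f := fun z : ℂ ↦ (riemannZetaZeroOrder z : ℝ) * (fordLaplace₀ f (s - z)).re)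
      (fun a _ b _ h ↦ Subtype.val_injective h)]
    congr 1
    ext z
    simp only [Finset.mem_image, Finset.mem_filter, hW, hP, mem_fordNearZeros]
    constructor
    · rintro ⟨ρ, ⟨-, hρ⟩, rfl⟩
      exact ⟨ZetaZeros.riemannZetaNontrivialZeros.zeta_eq_zero ρ.2, hρ⟩
    · rintro ⟨hζ, hz⟩
      have hre_eq : (1 + t * I - z).re = 1 - z.re := by simp
      have him_eq : (1 + t * I - z).im = t - z.im := by simp
      have hzre : 0 < z.re := by
        have h1 := Complex.abs_re_le_norm (1 + t * I - z)
        rw [hre_eq] at h1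
        have : |1 - z.re| ≤ η := h1.trans hz
        linarith [(abs_le.1 this).2]
      have hmem := ZetaZeros.riemannZetaNontrivialZeros.mem_of_re_pos hζ hzre
      refine ⟨⟨z, hmem⟩, ⟨?_, hz⟩, rfl⟩
      rw [mem_weilZeroFinset]
      have h1 := Complex.abs_im_le_norm (1 + t * I - z)
      rw [him_eq] at h1
      have : |t - z.im| ≤ η := h1.trans hz
      have := abs_sub_abs_le_abs_sub z.im t
      rw [abs_sub_comm] at this
      show |z.im| ≤ T
      linarith
  -- the far part
  have hfar : -(D * S) ≤ ∑ ρ ∈ W.filter (fun ρ ↦ ¬P ρ),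
      (riemannZetaZeroOrder (ρ : ℂ) : ℝ) * (fordLaplace₀ f (s - ρ)).re := by
    have hTS := hS ((W.filter (fun ρ ↦ ¬P ρ)).image Subtype.val) (by
      intro z hz
      rw [Finset.mem_image] at hz
      obtain ⟨ρ, hρ, rfl⟩ := hz
      rw [Finset.mem_filter] at hρ
      have hρ2 : η < ‖1 + t * I - (ρ : ℂ)‖ := not_le.1 hρ.2
      exact ⟨ZetaZeros.riemannZetaNontrivialZeros.zeta_eq_zero ρ.2,
        ZetaZeros.riemannZetaNontrivialZeros.re_pos ρ.2,
        ZetaZeros.riemannZetaNontrivialZeros.re_lt_one ρ.2, hρ2⟩)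
    rw [Finset.sum_image (fun a _ b _ h ↦ Subtype.val_injective h)] at hTS
    have hpt : ∀ ρ ∈ W.filter (fun ρ ↦ ¬P ρ),
        -(D * ((riemannZetaZeroOrder (ρ : ℂ) : ℝ) / ‖1 + t * I - (ρ : ℂ)‖ ^ 2)) ≤
          (riemannZetaZeroOrder (ρ : ℂ) : ℝ) * (fordLaplace₀ f (s - ρ)).re := by
      intro ρ hρ
      simp only [Finset.mem_filter, hP, not_le] at hρ
      have hηρ := hρ.2
      have hm : (0 : ℝ) ≤ (riemannZetaZeroOrder (ρ : ℂ) : ℝ) := by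
        have h1 : (1 : ℤ) ≤ riemannZetaZeroOrder (ρ : ℂ) :=
          ZetaZeros.riemannZetaNontrivialZeros.one_le_order ρ.2
        exact_mod_cast (zero_le_one.trans h1)
      have hlt1 := ZetaZeros.riemannZetaNontrivialZeros.re_lt_one ρ.2
      have hns := norm_one_add_sub_le_norm_sub (s := s) (ρ := (ρ : ℂ)) hs1 hlt1
      have hpos : 0 < ‖1 + t * I - (ρ : ℂ)‖ := hη.trans hηρ
      have hb := hf.laplace_bound (s - ρ) (by simp; linarith) (hηρ.le.trans hns)
      rw [← fordLaplace₀] at hb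
      have hb' : ‖fordLaplace₀ f (s - ρ)‖ ≤ D / ‖1 + t * I - (ρ : ℂ)‖ ^ 2 :=
        hb.trans (div_le_div_of_nonneg_left hD0 (by positivity) (pow_le_pow_left₀ hpos.le hns 2))
      have hre := (Complex.abs_re_le_norm (fordLaplace₀ f (s - ρ))).trans hb'
      have := (abs_le.1 hre).1
      have hmul := mul_le_mul_of_nonneg_left this hm
      calc -(D * ((riemannZetaZeroOrder (ρ : ℂ) : ℝ) / ‖1 + t * I - (ρ : ℂ)‖ ^ 2))
          = (riemannZetaZeroOrder (ρ : ℂ) : ℝ) * (-(D / ‖1 + t * I - (ρ : ℂ)‖ ^ 2)) := by ring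
        _ ≤ _ := hmul
    calc -(D * S) ≤ -(D * ∑ ρ ∈ W.filter (fun ρ ↦ ¬P ρ),
          (riemannZetaZeroOrder (ρ : ℂ) : ℝ) / ‖1 + t * I - (ρ : ℂ)‖ ^ 2) := by
            have := mul_le_mul_of_nonneg_left hTS hD0
            linarith
      _ = ∑ ρ ∈ W.filter (fun ρ ↦ ¬P ρ),
          -(D * ((riemannZetaZeroOrder (ρ : ℂ) : ℝ) / ‖1 + t * I - (ρ : ℂ)‖ ^ 2)) := by
            rw [Finset.mul_sum, ← Finset.sum_neg_distrib]
      _ ≤ _ := Finset.sum_le_sum hpt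
  rw [hnear]
  linarith

/-! ### Lemma 4.5 as an inequality for the real part -/

/-- **The core of Lemma 4.5, real part, with the left line as a parameter.** For an admissible
smoothing, `0 < η ≤ 1/2`, `1 < Re s ≤ 2`, a bound `S` of the strict far-zero sum, and any bound `Λ`
of `‖∫ G(−1/2 + iy) dy‖`:
`Re K(s) ≤ −f(0) Re ζ'/ζ(s) + Re F₀(s−1) − Σ_{|1+it−ρ|≤η} m(ρ) Re F₀(s−ρ) + D·S + Λ/(2π)`.
This is (4.6) + (4.7): `ford_contour_identity` along the good heights of
`ZetaZeroSum.exists_goodHeight_log`, horizontal sides `→ 0`, right side `→ 2π(K + f(0)ζ'/ζ)`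
(`integral_right_eq`), left side `→ ∫ G(−1/2 + iy) dy`, and at each finite height the zero sum split
by `nearSum_sub_le_re_zeroSum`. [cite: Ford2002Millennium, Lemma 4.5 and proof of Lemma 4.6] -/
theorem re_fordK_le_of_left_bound {f : ℝ → ℝ} {η D : ℝ} (hf : IsFordSmoothing f η D) (hη : 0 < η)
    (hη2 : η ≤ 1 / 2) {s : ℂ} (hs1 : 1 < s.re) (hs2 : s.re ≤ 2) {S : ℝ}
    (hS : FordFarZeroSumLT s.im η S) {Λ : ℝ}
    (hΛ : ‖∫ y : ℝ, smoothedEFIntegrand f s (((-(1 / 2) : ℝ) : ℂ) + y * I)‖ ≤ Λ) :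
    (fordK f s).re ≤ -(f 0) * (deriv riemannZeta s / riemannZeta s).re + (fordLaplace₀ f (s - 1)).re
      - (∑ ρ ∈ fordNearZeros s.im η, (riemannZetaZeroOrder ρ : ℝ) * (fordLaplace₀ f (s - ρ)).re)
      + D * S + Λ / (2 * π) := by
  obtain ⟨x₀, M, hx₀, hf0, -⟩ := hf.exists_support_bound
  have hfc := hf.contDiff.continuous
  have hD0 := hf.D_nonneg (by linarith)
  set σ := s.re with hσ
  set t := s.im with ht
  set α : ℝ := (1 + σ) / 2 with hα
  have hα1 : 1 < α := by rw [hα]; linarith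
  have hα2 : α ≤ 3 / 2 := by rw [hα]; linarith
  have hαs : α < s.re := by rw [hα]; linarith
  set G := smoothedEFIntegrand f s with hG
  -- good heights
  obtain ⟨Cz, hCz0, hCz⟩ := PsiOneExplicit.exists_norm_logDeriv_riemannZeta_horizontal_le
  obtain ⟨A, hA0, hA⟩ := ZetaZeroSum.exists_goodHeight_log
  have hgh : ∀ N : ℕ, ∃ T δ : ℝ, 2 ≤ N → ((N : ℝ) ≤ T ∧ T ≤ N + 1 ∧ 0 < δ ∧ δ ≤ 1 / 2 ∧
      1 / δ ≤ A * Real.log (N + 6) ∧ ∀ ρ ∈ RHWave0.riemannZetaNontrivialZeros, δ ≤ |ρ.im - T|) := by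
    intro N
    by_cases hN : 2 ≤ N
    · obtain ⟨T, h1, h2, δ, h3, h4, h5, h6⟩ := hA N hN
      exact ⟨T, δ, fun _ ↦ ⟨h1, h2, h3, h4, h5, h6⟩⟩
    · exact ⟨0, 0, fun h ↦ absurd h hN⟩
  choose T δ hTδ using hgh
  have hTtop : Tendsto T atTop atTop := by
    refine tendsto_atTop_mono' atTop ?_ tendsto_natCast_atTop_atTop
    filter_upwards [eventually_ge_atTop 2] with N hN using (hTδ N hN).1
  obtain ⟨N₀, hN₀⟩ := exists_nat_gt (2 * |t| + 2)
  have hbig : ∀ N : ℕ, max N₀ 2 ≤ N → 2 ≤ N ∧ |t| + 1 < T N ∧ (N : ℝ) / 2 ≤ T N - |t| := by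
    intro N hN
    have hN2 : 2 ≤ N := le_of_max_le_right hN
    have hNN₀ : (N₀ : ℝ) ≤ N := by exact_mod_cast le_of_max_le_left hN
    have hT := (hTδ N hN2).1
    refine ⟨hN2, by linarith [abs_nonneg t], by linarith [abs_nonneg t]⟩
  -- (1) the horizontal sides
  have hhor0 : ∀ sgn : ℝ, (sgn = 1 ∨ sgn = -1) →
      Tendsto (fun N : ℕ ↦ ∫ x : ℝ in (-(1 / 2) : ℝ)..α, G (x + ((sgn * T N : ℝ) : ℂ) * I))
        atTop (𝓝 0) := by
    intro sgn hsgn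
    refine squeeze_zero_norm' ?_
      (by simpa using ((ZetaZeroSum.tendsto_log_sq_div.const_mul (Cz * A * (D * 4) * 2))))
    filter_upwards [eventually_ge_atTop (max N₀ 2)] with N hN
    obtain ⟨hN2, hsN, hgapN⟩ := hbig N hN
    obtain ⟨h1, h2, h3, h4, h5, h6⟩ := hTδ N hN2
    have hN2' : (2 : ℝ) ≤ N := by exact_mod_cast hN2
    have hT2 : 2 ≤ T N := by linarith
    have hTabs : |sgn * T N| = T N := by
      rcases hsgn with rfl | rfl <;> simp [abs_of_pos (by linarith : 0 < T N)]
    have hsep : ∀ ρ ∈ RHWave0.riemannZetaNontrivialZeros, δ N ≤ |ρ.im - sgn * T N| := by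
      rcases hsgn with rfl | rfl
      · simpa using h6
      · intro ρ hρ
        have h := h6 _ (ZetaZeros.riemannZetaNontrivialZeros.conj_mem hρ)
        rw [conj_im] at h
        rwa [show |ρ.im - -1 * T N| = |-ρ.im - T N| by
          rw [show -ρ.im - T N = -(ρ.im - -1 * T N) by ring, abs_neg]]
    have hbd := norm_integral_horizontal_le hf hη hη2 hα1 hα2 hαs hCz0 hCz (T' := sgn * T N)
      (δ := δ N) (by rw [hTabs]; exact hT2) h3 (by linarith) hsep (by rw [hTabs]; linarith)
    rw [hTabs] at hbd
    refine hbd.trans ?_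
    set ℓ := Real.log ((N : ℝ) + 7) with hℓ
    have hℓ1 : 1 ≤ ℓ := by
      rw [hℓ, Real.le_log_iff_exp_le (by positivity)]; linarith [Real.exp_one_lt_d9]
    have hlog4 : Real.log (T N + 4) ≤ ℓ := Real.log_le_log (by linarith) (by linarith)
    have hlog40 : 0 ≤ Real.log (T N + 4) := Real.log_nonneg (by linarith)
    have hlog6 : Real.log ((N : ℝ) + 6) ≤ ℓ := Real.log_le_log (by linarith) (by linarith)
    have h1δ : 1 / δ N ≤ A * ℓ := h5.trans (mul_le_mul_of_nonneg_left hlog6 hA0.le)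
    have hN0 : (0 : ℝ) < N := by linarith
    have e1 : Cz * Real.log (T N + 4) / δ N ≤ Cz * A * ℓ ^ 2 := by
      calc Cz * Real.log (T N + 4) / δ N = Cz * Real.log (T N + 4) * (1 / δ N) := by ring
        _ ≤ Cz * ℓ * (A * ℓ) :=
            mul_le_mul (mul_le_mul_of_nonneg_left hlog4 hCz0.le) h1δ (by positivity) (by positivity)
        _ = Cz * A * ℓ ^ 2 := by ring
    have hsq : ((N : ℝ) / 2) ^ 2 ≤ (T N - |t|) ^ 2 := pow_le_pow_left₀ (by positivity) hgapN 2
    have hsq' : (N : ℝ) / 4 ≤ (T N - |t|) ^ 2 := by nlinarith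
    have e2 : D / (T N - |t|) ^ 2 ≤ D * 4 / N :=
      (div_le_div_of_nonneg_left hD0 (by positivity) hsq').trans_eq (by rw [div_div_eq_mul_div])
    have hα2' : α + 1 / 2 ≤ 2 := by linarith
    calc Cz * Real.log (T N + 4) / δ N * (D / (T N - |t|) ^ 2) * (α + 1 / 2)
        ≤ Cz * A * ℓ ^ 2 * (D * 4 / N) * 2 := by gcongr
      _ = Cz * A * (D * 4) * 2 * (ℓ ^ 2 / N) := by ring
  -- (2) the vertical sides
  obtain ⟨hIright, hvalright⟩ := integral_right_eq hf hη hα1 hαs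
  set R : ℂ := 2 * π * (fordK f s + (f 0 : ℂ) * (deriv riemannZeta s / riemannZeta s)) with hR
  have hright : Tendsto (fun N : ℕ ↦ ∫ y : ℝ in (-T N)..T N, G ((α : ℂ) + y * I)) atTop (𝓝 R) := by
    have h := intervalIntegral_tendsto_integral hIright (tendsto_neg_atTop_atBot.comp hTtop) hTtop
    rwa [hvalright] at h
  have hIleft := (norm_integral_left_le hf hη hη2 (s := s) hs1.le).1
  set L : ℂ := ∫ y : ℝ, G (((-(1 / 2) : ℝ) : ℂ) + y * I) with hL
  have hleft : Tendsto (fun N : ℕ ↦ ∫ y : ℝ in (-T N)..T N, G (((-(1 / 2) : ℝ) : ℂ) + y * I)) atTop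
      (𝓝 L) :=
    intervalIntegral_tendsto_integral hIleft (tendsto_neg_atTop_atBot.comp hTtop) hTtop
  -- (3) the boundary integral and its limit
  have hlim1 : Tendsto (fun N : ℕ ↦
      Literature.Analysis.Complex.rectBoundaryIntegral G (-(1 / 2)) α (-T N) (T N)) atTop
      (𝓝 (0 - 0 + I * R - I * L)) := by
    have hb := hhor0 (-1) (Or.inr rfl)
    have ht' := hhor0 1 (Or.inl rfl)
    simp only [neg_mul, one_mul] at hb ht'
    have := ((hb.sub ht').add (hright.const_mul I)).sub (hleft.const_mul I)
    refine this.congr fun N ↦ ?_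
    simp only [Literature.Analysis.Complex.rectBoundaryIntegral]
  -- the truncated zero sums
  set Z : ℕ → ℂ := fun N ↦ ∑ ρ ∈ weilZeroFinset (T N),
    (riemannZetaZeroOrder (ρ : ℂ) : ℂ) * fordLaplace₀ f (s - ρ) with hZ
  have hid : ∀ᶠ N : ℕ in atTop,
      Z N = fordLaplace₀ f (s - 1) -
        Literature.Analysis.Complex.rectBoundaryIntegral G (-(1 / 2)) α (-T N) (T N) / (2 * π * I) := by
    filter_upwards [eventually_ge_atTop (max N₀ 2)] with N hN
    obtain ⟨hN2, hsN, -⟩ := hbig N hN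
    obtain ⟨h1, h2, h3, h4, h5, h6⟩ := hTδ N hN2
    have hident := ford_contour_identity hfc hx₀ hf0 hα1 hα2 hαs (T := T N) (by linarith [abs_nonneg t])
      fun ρ hρ ↦ ⟨fun h ↦ ?_, fun h ↦ ?_⟩
    · have hπ : (2 * π * I : ℂ) ≠ 0 := by simp [Real.pi_ne_zero]
      rw [hZ]
      simp only
      rw [hident]
      field_simp
      ring
    · have := h6 ρ hρ
      rw [h, sub_self, abs_zero] at this
      linarith
    · have := h6 _ (ZetaZeros.riemannZetaNontrivialZeros.conj_mem hρ)
      rw [conj_im, h, neg_neg, sub_self, abs_zero] at this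
      linarith
  set Zlim : ℂ := fordLaplace₀ f (s - 1) - (0 - 0 + I * R - I * L) / (2 * π * I) with hZlim
  have hZt : Tendsto Z atTop (𝓝 Zlim) := by
    have h := tendsto_const_nhds (x := fordLaplace₀ f (s - 1)) |>.sub (hlim1.div_const (2 * π * I))
    exact h.congr' (hid.mono fun N h ↦ h.symm) |>.congr (fun N ↦ rfl)
  -- the inequality at finite height, and its limit
  set Near : ℝ := ∑ ρ ∈ fordNearZeros t η, (riemannZetaZeroOrder ρ : ℝ) * (fordLaplace₀ f (s - ρ)).re
  have hineq : ∀ᶠ N : ℕ in atTop, Near - D * S ≤ (Z N).re := by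
    filter_upwards [eventually_ge_atTop (max N₀ 2)] with N hN
    obtain ⟨hN2, hsN, -⟩ := hbig N hN
    exact nearSum_sub_le_re_zeroSum hf hη hη2 hs1.le hS (T := T N) (by linarith)
  have hlimre : Tendsto (fun N ↦ (Z N).re) atTop (𝓝 Zlim.re) := (Complex.continuous_re.tendsto _).comp hZt
  have hfinal : Near - D * S ≤ Zlim.re := ge_of_tendsto hlimre hineq
  -- evaluate `Re Zlim`
  have hπ0 : (π : ℝ) ≠ 0 := Real.pi_ne_zero
  have hZlim_re : Zlim.re = (fordLaplace₀ f (s - 1)).re - (fordK f s).re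
      - f 0 * (deriv riemannZeta s / riemannZeta s).re + L.re / (2 * π) := by
    have e : Zlim = fordLaplace₀ f (s - 1) - (fordK f s + (f 0 : ℂ) * (deriv riemannZeta s / riemannZeta s))
        + L / (2 * π) := by
      rw [hZlim, hR]
      have hI : (2 * π * I : ℂ) ≠ 0 := by simp [Real.pi_ne_zero]
      field_simp
      ring
    rw [e]
    simp only [sub_re, add_re, mul_re, ofReal_re, ofReal_im, zero_mul, sub_zero]
    rw [show (L / (2 * π) : ℂ) = L * (((1 / (2 * π) : ℝ)) : ℂ) by push_cast; field_simp]
    rw [Complex.mul_re]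
    simp
    ring
  rw [hZlim_re] at hfinal
  have hLre : L.re / (2 * π) ≤ Λ / (2 * π) :=
    div_le_div_of_nonneg_right ((Complex.re_le_norm L).trans hΛ) (by positivity)
  linarith

/-- **Ford 2002, Lemma 4.5 (with the far zeros bounded as in the proof of Lemma 4.6), real part.**
Let `f` be an admissible smoothing (`IsFordSmoothing f η D`, `0 < η ≤ 1/2`), `s = σ + it` with
`1 < σ ≤ 2`, and `S` a bound for the strict far-zero sum `Σ_{|1+it−ρ|>η} m(ρ)/|1+it−ρ|²`. Then
`Re K(s) ≤ −f(0) Re ζ'(s)/ζ(s) + Re F₀(s−1) − Σ_{|1+it−ρ|≤η} m(ρ) Re F₀(s−ρ) + D·S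
  + D(4.62/3 + (log 2)/3 + (1/6) log(1 + t²))`
(`re_fordK_le_of_left_bound` with `integral_left_bound`; Ford's `1.72` is `1.771…` once the slip
`10.8 → 11.13` in the source is corrected, and `(1/6) log(1+t²) ≤ (1/3) log(1+t)`).
[cite: Ford2002Millennium, Lemma 4.5 and proof of Lemma 4.6] -/
theorem re_fordK_le {f : ℝ → ℝ} {η D : ℝ} (hf : IsFordSmoothing f η D) (hη : 0 < η)
    (hη2 : η ≤ 1 / 2) {s : ℂ} (hs1 : 1 < s.re) (hs2 : s.re ≤ 2) {S : ℝ}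
    (hS : FordFarZeroSumLT s.im η S) :
    (fordK f s).re ≤ -(f 0) * (deriv riemannZeta s / riemannZeta s).re + (fordLaplace₀ f (s - 1)).re
      - (∑ ρ ∈ fordNearZeros s.im η, (riemannZetaZeroOrder ρ : ℝ) * (fordLaplace₀ f (s - ρ)).re)
      + D * S + D * (4.62 / 3 + Real.log 2 / 3 + 1 / 6 * Real.log (1 + s.im ^ 2)) := by
  have h := re_fordK_le_of_left_bound hf hη hη2 hs1 hs2 hS (integral_left_bound hf hη hη2 hs1.le).2
  have e : D * (2 * π * (4.62 / 3) + 1 / 3 * (π * Real.log (1 + s.im ^ 2) + 2 * π * Real.log 2)) / (2 * π)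
      = D * (4.62 / 3 + Real.log 2 / 3 + 1 / 6 * Real.log (1 + s.im ^ 2)) := by
    field_simp
    ring
  linarith

/-- **The same for real `s = σ ∈ (1, 2]`** (the case of `K(σ)` in the proof of Lemma 4.6), with the
sharper error `D(4.62/3 + (log 2)/3 − 1/16)` of `integral_left_bound_zero`.
[cite: Ford2002Millennium, Lemma 4.5 and proof of Lemma 4.6 (`K(1)`)] -/
theorem re_fordK_le_zero {f : ℝ → ℝ} {η D : ℝ} (hf : IsFordSmoothing f η D) (hη : 0 < η)
    (hη2 : η ≤ 1 / 2) {s : ℂ} (hs1 : 1 < s.re) (hs2 : s.re ≤ 2) (hs0 : s.im = 0) {S : ℝ}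
    (hS : FordFarZeroSumLT s.im η S) :
    (fordK f s).re ≤ -(f 0) * (deriv riemannZeta s / riemannZeta s).re + (fordLaplace₀ f (s - 1)).re
      - (∑ ρ ∈ fordNearZeros s.im η, (riemannZetaZeroOrder ρ : ℝ) * (fordLaplace₀ f (s - ρ)).re)
      + D * S + D * (4.62 / 3 + Real.log 2 / 3 - 1 / 16) := by
  have h := re_fordK_le_of_left_bound hf hη hη2 hs1 hs2 hS (integral_left_bound_zero hf hη hη2 hs1.le hs0)
  have e : D * (2 * π * (4.62 / 3) + 1 / 3 * (2 * π * Real.log 2 - 3 * π / 8)) / (2 * π)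
      = D * (4.62 / 3 + Real.log 2 / 3 - 1 / 16) := by
    field_simp
    ring
  linarith

end FordL45

end Literature.NumberTheory.LFunctions
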